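import Literature.AlgebraicGeometry.Motives.AlgPoints
import Literature.NumberTheory.Transcendental.AnalytificationSecondCountableProofs
import Mathlib.Topology.Algebra.MvPolynomial
import HarnessLib

/-!
# `X(L)` is locally compact for `L` a locally compact field (proof file)

Sibling proof file of `Literature/AlgebraicGeometry/Motives/AlgPoints.lean`. That file vendors as
a *named fact* `Literature.locallyCompactSpace_algPoints X L`: for a `k`-scheme `X` locally of finite
type (and separated) over `k` and a locally compact non-trivially normed field `L ⊇ k`, the space
`X(L)` of `L`-points with its strong topology `AlgPoints.instTopologicalSpace` is locally compact.
This file **discharges that fact** (`Literature.AlgebraicGeometry.Motives.locallyCompactSpace_algPoints_holds`) from Mathlib and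
the accepted `AlgPoints` API (including the point-set lemmas of
`Literature/NumberTheory/Transcendental/AnalytificationSecondCountableProofs.lean`).

The printed source is B. Conrad, *Weil and Grothendieck approaches to adelic points*, Enseign.
Math. **58** (2012): Prop. 2.1 (p. 2 of the author's version) — for `X = Spec A` affine of finite
type over a topological ring `R`, `X(R) = Hom_R(A, R) ⊆ R^A` has the weak topology of the
functions `a : X(R) → R`, a presentation `A ≃ R[t₁, …, tₙ]/I` identifies `X(R)` with the zero set
of `I` in `Rⁿ` *as a topological space*, which is closed when `R` is Hausdorff, «so when `R` is
also locally compact then so is `X(R)`»; and Prop. 3.1 (p. 4) — for `R` local with `R×` open and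
inversion continuous (e.g. a topological field) the topology on `X(R)` for `X` locally of finite
type is glued from the affine opens (`X(R) = ⋃ Uᵢ(R)` because `R` is local; an open immersion of
affines `U → X` gives an open embedding `U(R) → X(R)`, via `D(f)(R) = f⁻¹(R×)` and
`A_f = A[T]/(fT - 1)`), and «if `R` is locally compact and Hausdorff, then `X(R)` is locally
compact» (also Remark 3.2 for local fields). Separatedness of `X` is not used (it only serves
Hausdorffness), exactly as in the source.

## Proof

Everything is proved for `L`-points over any locally compact Hausdorff topological field `L ⊇ k`
(`[IsTopologicalDivisionRing L] [T1Space L] [LocallyCompactSpace L]`).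

* `Literature.AlgebraicGeometry.Motives.AlgPoints.eval_eq_appLE`: the value `f(P) ∈ L` of `f ∈ Γ(X, U)` at an `L`-point
  `P : Spec L → X` with `P.pt ∈ U` is `P^*(f) ∈ Γ(Spec L, 𝒪) = L` (Mathlib
  `Scheme.germ_stalkClosedPointTo`).
* `Literature.AlgebraicGeometry.Motives.AlgPoints.exists_eval_eq`: on an affine open `U`, every ring homomorphism
  `ψ : Γ(X, U) → L` compatible with `k → L` is evaluation at the `L`-point
  `Spec L → Spec Γ(X, U) = U ⊆ X` (Mathlib `IsAffineOpen.fromSpec`,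
  `IsAffineOpen.SpecMap_appLE_fromSpec` for the `Over` condition); i.e. `U(L) = Hom_k(Γ(X, U), L)`.
* `Literature.AlgebraicGeometry.Motives.AlgPoints.locallyCompactSpace_subtype_pt_mem` (Conrad, Prop. 2.1 with the key step of
  Prop. 3.1): for `U` affine, `Γ(X, U) = k[t₁, …, tₙ]/I` (`Scheme.Hom.finiteType_appLE`,
  `Algebra.FiniteType.iff_quotient_mvPolynomial''`) and the coordinate map
  `c = (t₁, …, tₙ) : U(L) → Lⁿ` is a topological embedding of the *subspace* `U(L) ⊆ X(L)`
  (every strong-open set is locally `U(L) ∩ c⁻¹(W)`: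
  `AlgPoints.exists_isOpen_inter_preimage_subset_basicSet`, the basic-open/localization argument
  of Prop. 3.1) whose image is the zero set of `I` in `Lⁿ` (`exists_eval_eq` and
  `RingHom.liftOfSurjective`), which is closed; hence `U(L)` is locally compact
  (`Topology.IsInducing.locallyCompactSpace`).
* `Literature.AlgebraicGeometry.Motives.locallyCompactSpace_algPoints_holds`: the sets `U(L)`, `U` affine open, are open in `X(L)`
  and cover it (`Spec L` is local), and local compactness is local for open subspaces
  (`Literature.AlgebraicGeometry.Motives.AlgPoints.locallyCompactSpace_of_forall_exists_isOpen`).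

## References

* B. Conrad, *Weil and Grothendieck approaches to adelic points*, Enseign. Math. (2) **58**
  (2012), 61–97, doi:10.4171/lem/58-1-3, Prop. 2.1, Prop. 3.1, Remark 3.2. [ConradAdelicPoints2012]
* J.-P. Serre, *Géométrie algébrique et géométrie analytique*, Ann. Inst. Fourier **6** (1956),
  §2 n°5 (Lemme 1 and the paragraph after Prop. 2: `X^h` «est un espace localement compact»).
* D. Mumford, *The Red Book of Varieties and Schemes*, I §10.
-/

noncomputable section

universe u

open CategoryTheory AlgebraicGeometry Topology TopologicalSpace IsLocalRing

namespace Literature.AlgebraicGeometry.Motives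

variable {k : Type u} [Field k]

namespace AlgPoints

variable {X : SchemeOver k} {L : Type u} [Field L] [Algebra k L]

/-! ### Values of regular functions as pull-backs to `Spec L` -/

/-- An `L`-point `P : Spec L → X` with `P.pt ∈ U` maps all of `Spec L` into `U`
(`Spec L` is local; Mathlib `Scheme.preimage_eq_top_of_closedPoint_mem`).
[Hartshorne II Ex. 2.7] [folklore] -/
theorem preimage_eq_top (P : AlgPoints X L) {U : X.left.Opens} (h : P.pt ∈ U) :
    P.left ⁻¹ᵁ U = ⊤ :=
  Scheme.preimage_eq_top_of_closedPoint_mem P.left h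

/-- The value `f(P) ∈ L` of `f ∈ Γ(X, U)` at an `L`-point `P` lying in `U` is the pull-back
`P^*(f) ∈ Γ(Spec L, 𝒪_{Spec L}) = L` (Mathlib `Scheme.germ_stalkClosedPointTo` and
`Scheme.ΓSpecIso`). [Hartshorne II Ex. 2.7] [folklore] -/
theorem eval_eq_appLE (P : AlgPoints X L) (U : X.left.Opens) (h : P.pt ∈ U)
    (f : Γ(X.left, U)) :
    P.eval U h f = (Scheme.ΓSpecIso (.of L)).hom
      (P.left.appLE U ⊤ (P.preimage_eq_top h).ge f) := by
  have h₀ : P.eval U h f =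
      Scheme.stalkClosedPointTo P.left (X.left.presheaf.germ U (P.left (closedPoint L)) h f) :=
    rfl
  have h₁ := CategoryTheory.congr_fun
    (Scheme.germ_stalkClosedPointTo (P.left : Spec (.of L) ⟶ X.left) U h) f
  refine (h₀.trans h₁).trans ?_
  simp only [Scheme.Hom.appLE, Iso.trans_hom, Functor.mapIso_hom, Iso.op_hom, eqToIso.hom]
  exact congrArg (fun i : (⊤ : (Spec (.of L)).Opens) ⟶ P.left ⁻¹ᵁ U =>
    (Scheme.ΓSpecIso (.of L)).hom (((Spec (.of L)).presheaf.map i.op) (P.left.app U f)))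
    (Subsingleton.elim _ _)

/-- For a ring map `φ : R → S`, pulling back a global section along `Spec φ` and identifying
`Γ(Spec _, 𝒪) = _` is applying `φ` (Mathlib `Scheme.ΓSpecIso_naturality`, in the `appLE ⊤ ⊤`
form). [Hartshorne II Prop. 2.3] [folklore] -/
theorem ΓSpecIso_hom_SpecMap_appLE_top {R S : CommRingCat.{u}} (φ : R ⟶ S)
    (e : (⊤ : (Spec S).Opens) ≤ Spec.map φ ⁻¹ᵁ ⊤) (s : Γ(Spec R, ⊤)) :
    (Scheme.ΓSpecIso S).hom ((Spec.map φ).appLE ⊤ ⊤ e s) = φ ((Scheme.ΓSpecIso R).hom s) := by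
  have h1 : (Spec.map φ).appLE ⊤ ⊤ e = (Spec.map φ).appTop := (Spec.map φ).appLE_eq_app
  rw [h1, ← CommRingCat.comp_apply, Scheme.ΓSpecIso_naturality, CommRingCat.comp_apply]

/-! ### `L`-points of an affine open are the `k`-algebra maps `Γ(X, U) → L` -/

/-- **`U(L) = Hom_k(Γ(X, U), L)` for `U` affine (surjectivity).** For an affine open `U ⊆ X` and
a ring homomorphism `ψ : Γ(X, U) → L` compatible with the structure maps `k → Γ(X, U)` and
`k → L`, the `L`-point `Spec L → Spec Γ(X, U) = U ⊆ X` lies in `U` and evaluation at it is `ψ`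
(Mathlib `IsAffineOpen.fromSpec`; the `Over` condition by `IsAffineOpen.SpecMap_appLE_fromSpec`).
[Hartshorne II Ex. 2.7 and Prop. 2.3; Conrad, Prop. 2.1: `X(R) = Hom_{R-alg}(A, R)`] [folklore] -/
theorem exists_eval_eq {U : X.left.Opens} (hU : IsAffineOpen U) (ψ : Γ(X.left, U) →+* L)
    (hψ : ψ.comp ((X.hom.appLE ⊤ U le_top).hom.comp (Scheme.ΓSpecIso (.of k)).inv.hom) =
      algebraMap k L) :
    ∃ P : AlgPoints X L, ∃ h : P.pt ∈ U, ∀ a, P.eval U h a = ψ a := by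
  set q : Spec (.of L) ⟶ X.left := Spec.map (CommRingCat.ofHom ψ) ≫ hU.fromSpec with hq_def
  have hq : q ≫ X.hom = Spec.map (CommRingCat.ofHom (algebraMap k L)) := by
    have h1 := IsAffineOpen.SpecMap_appLE_fromSpec X.hom (isAffineOpen_top _) hU
      (V := U) (U := ⊤) le_top
    rw [IsAffineOpen.fromSpec_top, Scheme.isoSpec_Spec_inv, ← Spec.map_comp] at h1
    rw [hq_def, Category.assoc, ← h1, ← Spec.map_comp, ← hψ]
    rfl
  refine ⟨Over.homMk q hq, ?_, ?_⟩
  · have : hU.fromSpec (Spec.map (CommRingCat.ofHom ψ) (closedPoint L)) ∈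
        Set.range hU.fromSpec :=
      Set.mem_range_self _
    rwa [hU.range_fromSpec] at this
  · intro a
    rw [eval_eq_appLE]
    change (Scheme.ΓSpecIso (.of L)).hom
      ((Spec.map (CommRingCat.ofHom ψ) ≫ hU.fromSpec).appLE U ⊤ _ a) = ψ a
    rw [Scheme.Hom.comp_appLE, hU.fromSpec_app_self]
    simp only [Category.assoc, Scheme.Hom.map_appLE]
    rw [CommRingCat.comp_apply, ΓSpecIso_hom_SpecMap_appLE_top]
    exact congrArg ψ (Iso.inv_hom_id_apply _ a)

/-! ### Affine charts are locally compact -/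

section Chart

variable [TopologicalSpace L] [IsTopologicalDivisionRing L] [T1Space L] [LocallyCompactSpace L]

/-- **An affine chart `U(L) ⊆ X(L)` is locally compact** (Conrad, Prop. 2.1, with the key step
of Prop. 3.1). For `X` locally of finite type over `k`, `U ⊆ X` an affine open and `L ⊇ k` a
locally compact Hausdorff topological field: writing `Γ(X, U) = k[t₁, …, tₙ]/I`, the coordinate
map `(t₁, …, tₙ) : U(L) → Lⁿ` is a topological embedding of the subspace `U(L)` of `X(L)`
(strong-open sets are locally pulled back from `Lⁿ`,
`AlgPoints.exists_isOpen_inter_preimage_subset_basicSet`) onto the zero set of `I`, which is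
closed; a closed subspace of `Lⁿ` is locally compact.
[cite: ConradAdelicPoints2012, Prop. 2.1 and Prop. 3.1] -/
theorem locallyCompactSpace_subtype_pt_mem [LocallyOfFiniteType X.hom] {U : X.left.Opens}
    (hU : IsAffineOpen U) :
    LocallyCompactSpace {P : AlgPoints X L // P.pt ∈ U} := by
  -- the `k`-algebra structure on `Γ(X, U)` and a presentation `F : k[t₁, …, tₙ] ↠ Γ(X, U)`
  set g : k →+* Γ(X.left, U) :=
    (X.hom.appLE ⊤ U le_top).hom.comp (Scheme.ΓSpecIso (.of k)).inv.hom with hg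
  letI : Algebra k Γ(X.left, U) := g.toAlgebra
  have hft : Algebra.FiniteType k Γ(X.left, U) := by
    have h1 : (X.hom.appLE ⊤ U le_top).hom.FiniteType :=
      X.hom.finiteType_appLE (isAffineOpen_top _) hU le_top
    have h2 : (Scheme.ΓSpecIso (.of k)).inv.hom.FiniteType :=
      RingHom.FiniteType.of_surjective _
        (Scheme.ΓSpecIso (.of k)).symm.commRingCatIsoToRingEquiv.surjective
    exact h1.comp h2
  obtain ⟨n, F, hF⟩ := Algebra.FiniteType.iff_quotient_mvPolynomial''.mp hft
  -- evaluation at a point of the chart is a `k`-algebra homomorphism `Γ(X, U) → L`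
  have hcomm : ∀ (Q : {P : AlgPoints X L // P.pt ∈ U}) (c : k),
      Q.1.eval U Q.2 (algebraMap k Γ(X.left, U) c) = algebraMap k L c := by
    intro Q c
    rw [RingHom.algebraMap_toAlgebra]
    change Q.1.eval U Q.2 (X.hom.appLE ⊤ U le_top ((Scheme.ΓSpecIso (.of k)).inv c)) = _
    rw [eval_appLE_top]
    congr 1
    exact Iso.inv_hom_id_apply _ _
  let evₐ : {P : AlgPoints X L // P.pt ∈ U} → (Γ(X.left, U) →ₐ[k] L) := fun Q =>
    { toRingHom := (X.left.evaluation U Q.1.pt Q.2 ≫ Q.1.resHom).hom, commutes' := hcomm Q }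
  have hevₐ : ∀ Q a, evₐ Q a = Q.1.eval U Q.2 a := fun _ _ => rfl
  -- the chart `c = (t₁, …, tₙ) : U(L) → Lⁿ`; regular functions are polynomials in the `tⱼ`
  set c : {P : AlgPoints X L // P.pt ∈ U} → (Fin n → L) :=
    fun Q i => Q.1.eval U Q.2 (F (MvPolynomial.X i)) with hc_def
  have hcF : ∀ Q p, Q.1.eval U Q.2 (F p) = MvPolynomial.aeval (c Q) p := by
    intro Q p
    have : (evₐ Q).comp F = MvPolynomial.aeval (c Q) :=
      MvPolynomial.algHom_ext fun i => by simp [hevₐ, hc_def]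
    rw [← hevₐ, ← AlgHom.comp_apply, this]
  have hx : ∀ a : Γ(X.left, U), ∃ p : MvPolynomial (Fin n) L, ∀ (Q : AlgPoints X L)
      (h : Q.pt ∈ U), Q.eval U h a =
        MvPolynomial.eval (fun j => Q.eval U h (F (MvPolynomial.X j))) p := by
    intro a
    obtain ⟨p, rfl⟩ := hF a
    refine ⟨MvPolynomial.map (algebraMap k L) p, fun Q h => ?_⟩
    rw [MvPolynomial.eval_map, ← MvPolynomial.aeval_def]
    exact hcF ⟨Q, h⟩ p
  -- `c` is continuous
  have hcont : ∀ a : Γ(X.left, U),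
      Continuous fun Q : {P : AlgPoints X L // P.pt ∈ U} => Q.1.eval U Q.2 a := by
    intro a
    refine continuous_def.mpr fun V hV => ?_
    have : (fun Q : {P : AlgPoints X L // P.pt ∈ U} => Q.1.eval U Q.2 a) ⁻¹' V =
        Subtype.val ⁻¹' basicSet U a V := by
      ext Q
      exact ⟨fun h => ⟨Q.2, h⟩, fun ⟨_, h⟩ => h⟩
    rw [this]
    exact (isOpen_basicSet U a hV).preimage continuous_subtype_val
  have hc : Continuous c := continuous_pi fun i => hcont _
  -- `c` is inducing: every strong-open set is locally pulled back from `Lⁿ`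
  have hind : IsInducing c := by
    refine ⟨le_antisymm (continuous_iff_le_induced.mp hc) ?_⟩
    rw [instTopologicalSpaceSubtype, instTopologicalSpace, induced_generateFrom_eq]
    refine le_generateFrom ?_
    rintro _ ⟨_, ⟨U', f, V, hV, rfl⟩, rfl⟩
    rw [@isOpen_iff_forall_mem_open]
    intro Q hQ
    obtain ⟨W, hW, hQW, hWsub⟩ :=
      exists_isOpen_inter_preimage_subset_basicSet hU _ hx U' f hV hQ Q.2
    have hcW : ∀ Q' : {P : AlgPoints X L // P.pt ∈ U},
        (fun j => evalOrZero U (F (MvPolynomial.X j)) Q'.1) = c Q' :=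
      fun Q' => funext fun j => evalOrZero_of_mem _ Q'.2
    refine ⟨c ⁻¹' W, fun Q' hQ' => hWsub ⟨Q'.2, ?_⟩, isOpen_induced hW, ?_⟩
    · rw [Set.mem_preimage, hcW Q']
      exact hQ'
    · rw [Set.mem_preimage, ← hcW Q]
      exact hQW
  -- polynomial maps `Lⁿ → L` are continuous
  have haeval : ∀ p : MvPolynomial (Fin n) k,
      Continuous fun v : Fin n → L => MvPolynomial.aeval v p := by
    intro p
    have : (fun v : Fin n → L => MvPolynomial.aeval v p) =
        fun v => MvPolynomial.eval v (MvPolynomial.map (algebraMap k L) p) := by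
      ext v
      rw [MvPolynomial.eval_map, MvPolynomial.aeval_def]
    rw [this]
    exact MvPolynomial.continuous_eval _
  -- the range of `c` is the (closed) zero set of the relations `I = ker F`
  have hrange : Set.range c =
      {v | ∀ p : MvPolynomial (Fin n) k, F p = 0 → MvPolynomial.aeval v p = 0} := by
    ext v
    constructor
    · rintro ⟨Q, rfl⟩ p hp
      rw [← hcF, hp, ← hevₐ, map_zero]
    · intro hv
      let ψ : Γ(X.left, U) →+* L := F.toRingHom.liftOfSurjective hF
        ⟨(MvPolynomial.aeval v).toRingHom, fun p hp => hv p hp⟩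
      have hψF : ∀ p, ψ (F p) = MvPolynomial.aeval v p := fun p =>
        F.toRingHom.liftOfSurjective_comp_apply hF _ p
      have hψ : ψ.comp g = algebraMap k L := by
        ext x
        have h1 : g x = F (algebraMap k _ x) := (F.commutes x).symm
        rw [RingHom.comp_apply, h1, hψF, AlgHom.commutes]
      obtain ⟨P, hP, hPψ⟩ := exists_eval_eq hU ψ hψ
      refine ⟨⟨P, hP⟩, funext fun i => ?_⟩
      simp only [hc_def, hPψ, hψF, MvPolynomial.aeval_X]
  have hclosed : IsClosed (Set.range c) := by
    rw [hrange]
    have : {v : Fin n → L | ∀ p : MvPolynomial (Fin n) k, F p = 0 → MvPolynomial.aeval v p = 0} =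
        ⋂ p ∈ {p : MvPolynomial (Fin n) k | F p = 0},
          (fun v : Fin n → L => MvPolynomial.aeval v p) ⁻¹' {0} := by
      ext v
      simp
    rw [this]
    exact isClosed_biInter fun p _ => isClosed_singleton.preimage (haeval p)
  exact hind.locallyCompactSpace hclosed.isLocallyClosed

end Chart

/-- **Local compactness is local**: a space covered by open, locally compact subspaces is
locally compact (no separation assumed). [folklore] -/
theorem locallyCompactSpace_of_forall_exists_isOpen {T : Type*} [TopologicalSpace T]
    (h : ∀ x : T, ∃ s : Set T, IsOpen s ∧ x ∈ s ∧ LocallyCompactSpace s) :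
    LocallyCompactSpace T := by
  refine ⟨fun x N hN => ?_⟩
  obtain ⟨s, hs, hx, hlc⟩ := h x
  obtain ⟨K, hK, hKN, hKc⟩ := local_compact_nhds (x := (⟨x, hx⟩ : s)) (n := Subtype.val ⁻¹' N)
    (continuous_subtype_val.continuousAt.preimage_mem_nhds hN)
  exact ⟨Subtype.val '' K, hs.isOpenMap_subtype_val.image_mem_nhds hK,
    Set.image_subset_iff.mpr hKN, hKc.image continuous_subtype_val⟩

end AlgPoints

/-! ### The named fact -/

/-- **`X(L)` is locally compact** (Conrad, *Weil and Grothendieck approaches to adelic points*,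
Prop. 3.1 with Prop. 2.1 and Remark 3.2): the named fact `Literature.locallyCompactSpace_algPoints X L`
of `Literature/AlgebraicGeometry/Motives/AlgPoints.lean` holds — for `X` locally of finite type
(and separated) over `k` and `L ⊇ k` a locally compact non-trivially normed field, `X(L)` with
its strong topology is locally compact. Proof: `X(L)` is covered by the open sets `U(L)`, `U ⊆ X`
affine open (`Spec L` is local), each locally compact
(`AlgPoints.locallyCompactSpace_subtype_pt_mem`), and local compactness is local. The
separatedness hypothesis of the fact is not used.
[cite: ConradAdelicPoints2012, Prop. 3.1 (and Prop. 2.1, Remark 3.2)] -/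
theorem locallyCompactSpace_algPoints_holds (X : SchemeOver k) (L : Type u) :
    locallyCompactSpace_algPoints X L := by
  intro _ _ _ _ _
  refine AlgPoints.locallyCompactSpace_of_forall_exists_isOpen fun P => ?_
  obtain ⟨_, ⟨U, hU, rfl⟩, hPU, -⟩ :=
    X.left.isBasis_affineOpens.exists_subset_of_mem_open (Set.mem_univ P.pt) isOpen_univ
  exact ⟨{Q | Q.pt ∈ U}, AlgPoints.isOpen_setOf_pt_mem U, hPU,
    AlgPoints.locallyCompactSpace_subtype_pt_mem hU⟩

end Literature.AlgebraicGeometry.Motives
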